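/-
Origin: expansion seat `planner-pub-hodgecm-toy-g5-0`, handover #7 2026-08-18T15:40:37Z (md5 2a120d90) (`HOME/pub-hodgecm-toy-g5/lean/ToyG5/HodgeQuotient3.lean`, md5 2a120d90, 309 lines);
landed by the gen-8 packager in gate run 31 as `HodgeCM/Model/ToyG2/HodgeQuotient3.lean` (import ^import ToyG5\.HodgeRiemannType3[ \t]*$→import HodgeCM.Model.ToyG2.HodgeRiemannType3 ×1).
-/
-- HANDOVER (planner-pub-hodgecm-toy-g5-0, unit pub-hodgecm-toy-g5): WIP module `ToyG5.HodgeQuotient3`; intended final module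
-- `HodgeCM.Model.ToyG2.HodgeQuotient3` (kind L5, toy model / consistency witness, EXPANSION part (e), generation 5);
-- rename `import ToyG5.X` ↦ `import HodgeCM.Model.ToyG2.X` (one import: `HodgeRiemannType3`, file #6 of this seat).
/-
Copyright (c) 2026. All rights reserved.
Released under Apache 2.0 license as described in the file LICENSE.
-/
import Mathlib
import Summits.HodgeConjecture.HodgeCM.Model.ToyG2.HodgeRiemannType3

/-!
# The quotient Hodge structure `H²(P_Γ, ℚ) ⧸ N_ℚ` and HR20 on it

File #7 of generation 5 of the toy lineage (seat `planner-pub-hodgecm-toy-g5-0`).  Files #1–#6: in `toyUniverse₃ d t` (`1 ≤ d`,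
`t² = 16`) the Hodge–Riemann relation HR20 fails on `H²(P_Γ) = ⋀²H¹` exactly along `ℂ ⊗ N_ℚ`, `N_ℚ = Universe.trCupRad _ P_Γ 2` the radical
of the rational pairing `tr(x ∪ y)`, and `N_ℚ` is a sub-Hodge structure (`hr3s_ratRadical_subHS`).  This file performs the first step of
the generation-6 repair `H²(P_Γ, ℚ) ↦ H²(P_Γ, ℚ) ⧸ N_ℚ`:

* §1 (GENERIC linear algebra of Hodge structures, namespace `HodgeCM.QuotHS`; `H : HodgeStructure V n`, `N : Submodule ℚ V`):
  the splitting criterion `IsSubHS H N` (`N_ℂ ⊆ (N_ℂ ∩ F^p) + (N_ℂ ∩ conj F^q)` for `p + q = n + 1`), its derivation from a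
  decomposition of `N_ℂ` into pieces of Hodge type (`isSubHS_of_le_pieces`), the complexified quotient map
  `N.mkQ.baseChange ℂ : V_ℂ → (V ⧸ N)_ℂ` (surjective, kernel `N_ℂ`: `mkQ_baseChange_surjective`, `ker_mkQ_baseChange` — right exactness of
  `ℂ ⊗_ℚ –`), `complexConj_map_baseChange`, and **`QuotHS.quot H N (hN : IsSubHS H N) : HodgeStructure (V ⧸ N) n`**, the quotient
  Hodge structure with filtration `F^p (V ⧸ N)_ℂ = image of F^p V_ℂ` (`quot_F`);
* §2 (toy): `hr3t_isSubHS` (from file #6), **`hr3t_quotHodge d t ι₁ Γ : HodgeStructure (H²(P_Γ, ℚ) ⧸ N_ℚ) 2`**, and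
  **`hr3t_HR20_quot`** (`1 ≤ d`, `t² = 16`): every nonzero `ξ ∈ F²` of the quotient is the image of some `η ∈ F²H²(P_Γ)`, and EVERY such
  lift has `tr_ℂ(η ∪ conj η) ≠ 0` — the Hodge–Riemann relation HR20, which fails for `H²(P_Γ)` (file #1), HOLDS for the quotient
  `H²(P_Γ) ⧸ N_ℚ` in the lifted form; `hr3t_HR_form_lift_indep` (any `d t`): the value `tr_ℂ(η ∪ conj η)` does not depend on the
  lift; `hr3t_quot_F2_ne_bot`: the quotient has NONZERO `F²` (the class `E_{q,2} ∪ E_{q,3}` of any block survives, by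
  `ThetaGram.Λ_theta23_ne_zero`), so HR20 on the quotient is not vacuous; `hr3t_quot_summary` packages both.

Nothing cited, nothing posited, no unfinished proofs.
-/

open scoped TensorProduct
open Literature.AlgebraicGeometry.Motives
open Literature.AlgebraicGeometry.Motives.HodgeStructure (conj complexConj conj_smul conj_conj conj_baseChange
  mem_complexConj complexConj_mono)

namespace HodgeCM

noncomputable section

/-! ### §1 Quotient of a Hodge structure by a sub-Hodge structure (generic) -/

namespace QuotHS

universe u v

variable {V : Type u} [AddCommGroup V] [Module ℚ V] {W : Type v} [AddCommGroup W] [Module ℚ W] {n : ℤ}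

/-- the splitting criterion for a rational subspace `N ⊆ V` to be a sub-Hodge structure of `H`: for every `p + q = n + 1`,
`N_ℂ ⊆ (N_ℂ ∩ F^p) + (N_ℂ ∩ conj F^q)` (i.e. the decomposition `V_ℂ = F^p ⊕ conj F^q` restricts to `N_ℂ`) -/
def IsSubHS (H : HodgeStructure V n) (N : Submodule ℚ V) : Prop :=
  ∀ p q : ℤ, p + q = n + 1 →
    N.baseChange ℂ ≤ (N.baseChange ℂ ⊓ H.F p) ⊔ (N.baseChange ℂ ⊓ complexConj (H.F q))

/-- a Hodge piece `V^{p',q'}` lies in `F^p` or in `conj F^q` whenever `p + q = n + 1` -/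
theorem piece_le_F_or (H : HodgeStructure V n) {p' q' p q : ℤ} (h' : p' + q' = n) (h : p + q = n + 1) :
    H.piece p' q' ≤ H.F p ∨ H.piece p' q' ≤ complexConj (H.F q) := by
  rcases le_or_gt p p' with hp | hp
  · exact Or.inl ((H.piece_le_F p' q').trans (H.antitone_F hp))
  · exact Or.inr ((H.piece_le_complexConj_F p' q').trans (complexConj_mono (H.antitone_F (by omega))))

/-- **splitting from Hodge type**: if `N_ℂ` is contained in the span of its intersections with Hodge pieces, `N` is a sub-Hodge
structure -/
theorem isSubHS_of_le_pieces (H : HodgeStructure V n) (N : Submodule ℚ V) {ι : Type*} (p q : ι → ℤ)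
    (hpq : ∀ i, p i + q i = n) (hN : N.baseChange ℂ ≤ ⨆ i, (N.baseChange ℂ ⊓ H.piece (p i) (q i))) :
    IsSubHS H N := by
  intro a b hab
  refine hN.trans (iSup_le fun i => ?_)
  rcases piece_le_F_or H (hpq i) hab with h | h
  · exact le_sup_of_le_left (inf_le_inf_left _ h)
  · exact le_sup_of_le_right (inf_le_inf_left _ h)

/-- the complexified quotient map `V_ℂ → (V ⧸ N)_ℂ` is surjective -/
theorem mkQ_baseChange_surjective (N : Submodule ℚ V) : Function.Surjective (N.mkQ.baseChange ℂ) :=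
  LinearMap.lTensor_surjective ℂ N.mkQ_surjective

/-- **right exactness of `ℂ ⊗_ℚ –`**: the kernel of `V_ℂ → (V ⧸ N)_ℂ` is `N_ℂ` -/
theorem mem_ker_mkQ_baseChange_iff (N : Submodule ℚ V) (x : ℂ ⊗[ℚ] V) :
    N.mkQ.baseChange ℂ x = 0 ↔ x ∈ N.baseChange ℂ := by
  have h1 : (N.mkQ.baseChange ℂ x = 0) ↔ x ∈ LinearMap.ker (LinearMap.lTensor ℂ N.mkQ) := Iff.rfl
  rw [h1, lTensor_mkQ]
  exact Iff.rfl

/-- (Ported verbatim from the HodgeCMPerL package; no docstring in the source.) -/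
theorem ker_mkQ_baseChange (N : Submodule ℚ V) : LinearMap.ker (N.mkQ.baseChange ℂ) = N.baseChange ℂ :=
  Submodule.ext fun x => mem_ker_mkQ_baseChange_iff N x

/-- (Ported verbatim from the HodgeCMPerL package; no docstring in the source.) -/
theorem range_mkQ_baseChange (N : Submodule ℚ V) : LinearMap.range (N.mkQ.baseChange ℂ) = ⊤ :=
  LinearMap.range_eq_top.mpr (mkQ_baseChange_surjective N)

/-- complex conjugation commutes with images under base-changed rational maps -/
theorem complexConj_map_baseChange (f : V →ₗ[ℚ] W) (U : Submodule ℂ (ℂ ⊗[ℚ] V)) :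
    complexConj (U.map (f.baseChange ℂ)) = (complexConj U).map (f.baseChange ℂ) := by
  ext x
  simp only [mem_complexConj, Submodule.mem_map]
  constructor
  · rintro ⟨u, hu, hux⟩
    exact ⟨conj u, by rwa [conj_conj], by rw [← conj_baseChange, hux, conj_conj]⟩
  · rintro ⟨u, hu, hux⟩
    exact ⟨conj u, hu, by rw [← conj_baseChange, hux]⟩

/-- **the quotient Hodge structure** of `H` by a sub-Hodge structure `N`: weight `n`, filtration the image filtration
`F^p (V ⧸ N)_ℂ := image of F^p V_ℂ` under `V_ℂ → (V ⧸ N)_ℂ` -/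
def quot (H : HodgeStructure V n) (N : Submodule ℚ V) (hN : IsSubHS H N) : HodgeStructure (V ⧸ N) n where
  F p := (H.F p).map (N.mkQ.baseChange ℂ)
  antitone_F _ _ h := Submodule.map_mono (H.antitone_F h)
  exists_F_eq_top := by
    obtain ⟨p, hp⟩ := H.exists_F_eq_top
    exact ⟨p, by rw [hp, Submodule.map_top, range_mkQ_baseChange]⟩
  exists_F_eq_bot := by
    obtain ⟨p, hp⟩ := H.exists_F_eq_bot
    exact ⟨p, by rw [hp, Submodule.map_bot]⟩
  isCompl_F_complexConj p q h := by
    rw [complexConj_map_baseChange]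
    refine ⟨?_, ?_⟩
    · rw [Submodule.disjoint_def]
      rintro x ⟨f, hf, rfl⟩ ⟨g, hg, hgf⟩
      -- `f ∈ F^p`, `g ∈ conj F^q` with the same image: `f - g ∈ N_ℂ` splits as `a + b`, `a ∈ N_ℂ ∩ F^p`, `b ∈ N_ℂ ∩ conj F^q`
      have hker : f - g ∈ N.baseChange ℂ := by
        rw [← mem_ker_mkQ_baseChange_iff, map_sub, hgf, sub_self]
      obtain ⟨a, ha, b, hb, hab⟩ := Submodule.mem_sup.mp (hN p q h hker)
      have hfa : f - a ∈ H.F p ⊓ complexConj (H.F q) := by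
        refine Submodule.mem_inf.mpr ⟨Submodule.sub_mem _ hf (Submodule.mem_inf.mp ha).2, ?_⟩
        have e : f - a = g + b :=
          calc f - a = (f - g) - a + g := by abel
            _ = (a + b) - a + g := by rw [hab]
            _ = g + b := by abel
        rw [e]
        exact Submodule.add_mem _ hg (Submodule.mem_inf.mp hb).2
      rw [(H.isCompl_F_complexConj p q h).inf_eq_bot, Submodule.mem_bot, sub_eq_zero] at hfa
      rw [hfa]
      exact (mem_ker_mkQ_baseChange_iff N a).mpr (Submodule.mem_inf.mp ha).1
    · rw [codisjoint_iff, ← Submodule.map_sup, (H.isCompl_F_complexConj p q h).sup_eq_top, Submodule.map_top,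
        range_mkQ_baseChange]

/-- (Ported verbatim from the HodgeCMPerL package; no docstring in the source.) -/
@[simp]
theorem quot_F (H : HodgeStructure V n) (N : Submodule ℚ V) (hN : IsSubHS H N) (p : ℤ) :
    (quot H N hN).F p = (H.F p).map (N.mkQ.baseChange ℂ) := rfl

/-- every class of `F^p` of the quotient lifts to `F^p` -/
theorem exists_lift_of_mem_quot_F (H : HodgeStructure V n) (N : Submodule ℚ V) (hN : IsSubHS H N) {p : ℤ}
    {ξ : ℂ ⊗[ℚ] (V ⧸ N)} (hξ : ξ ∈ (quot H N hN).F p) : ∃ η ∈ H.F p, N.mkQ.baseChange ℂ η = ξ :=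
  Submodule.mem_map.mp hξ

/-- the conjugate filtration of the quotient is the image of the conjugate filtration -/
theorem complexConj_quot_F (H : HodgeStructure V n) (N : Submodule ℚ V) (hN : IsSubHS H N) (q : ℤ) :
    complexConj ((quot H N hN).F q) = (complexConj (H.F q)).map (N.mkQ.baseChange ℂ) :=
  complexConj_map_baseChange _ _

/-- the image of a Hodge piece lies in the corresponding piece of the quotient -/
theorem map_piece_le_quot_piece (H : HodgeStructure V n) (N : Submodule ℚ V) (hN : IsSubHS H N) (p q : ℤ) :
    (H.piece p q).map (N.mkQ.baseChange ℂ) ≤ (quot H N hN).piece p q := by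
  by_cases h : p + q = n
  · rw [H.piece_of_add_eq h, (quot H N hN).piece_of_add_eq h, complexConj_quot_F]
    exact (Submodule.map_inf_le _).trans le_rfl
  · rw [H.piece_eq_bot_of_add_ne h, Submodule.map_bot]
    exact bot_le

end QuotHS

/-! ### §2 The quotient `H²(P_Γ, ℚ) ⧸ N_ℚ` of `toyUniverse₃` and HR20 on it -/

namespace ToyG2

open HodgeCM.Toy HodgeCM.Toy.CMPresentation ThetaUiso

variable (d t : ℚ) {L : CMField} (ι₁ : L →+* ℂ) {V : HermSpace3 L ι₁} (Γ : Level V)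

/-- `N_ℚ ⊆ H²(P_Γ, ℚ)` satisfies the splitting criterion (from `hr3s_ratRadical_subHS`), for every `d t` -/
theorem hr3t_isSubHS :
    QuotHS.IsSubHS ((toyUniverse₃ d t).hodge ((toyUniverse₃ d t).pms L ι₁ V Γ) 2)
      ((toyUniverse₃ d t).trCupRad ((toyUniverse₃ d t).pms L ι₁ V Γ) 2) := by
  refine QuotHS.isSubHS_of_le_pieces _ _ (fun p' : ℤ => p') (fun p' => 2 - p') (fun _ => by omega) ?_
  refine (hr3s_ratRadical_subHS d t ι₁ Γ).le.trans (sup_le (sup_le ?_ ?_) ?_)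
  · refine le_iSup_of_le (2 : ℤ) (le_of_eq ?_)
    simp only [show (2 : ℤ) - 2 = 0 by norm_num]
  · refine le_iSup_of_le (1 : ℤ) (le_of_eq ?_)
    simp only [show (2 : ℤ) - 1 = 1 by norm_num]
  · refine le_iSup_of_le (0 : ℤ) (le_of_eq ?_)
    simp only [show (2 : ℤ) - 0 = 2 by norm_num]

/-- **the quotient Hodge structure** of weight 2 on `H²(P_Γ, ℚ) ⧸ N_ℚ` (any `d t`) -/
def hr3t_quotHodge :
    HodgeStructure ((toyUniverse₃ d t).Coh ((toyUniverse₃ d t).pms L ι₁ V Γ) 2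
      ⧸ (toyUniverse₃ d t).trCupRad ((toyUniverse₃ d t).pms L ι₁ V Γ) 2) 2 :=
  QuotHS.quot _ _ (hr3t_isSubHS d t ι₁ Γ)

/-- (Ported verbatim from the HodgeCMPerL package; no docstring in the source.) -/
theorem hr3t_quotHodge_F (p : ℤ) :
    (hr3t_quotHodge d t ι₁ Γ).F p
      = (((toyUniverse₃ d t).hodge ((toyUniverse₃ d t).pms L ι₁ V Γ) 2).F p).map
          (((toyUniverse₃ d t).trCupRad ((toyUniverse₃ d t).pms L ι₁ V Γ) 2).mkQ.baseChange ℂ) := rfl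

/-- the value of the Hodge–Riemann form `tr_ℂ(η ∪ conj η)` does not depend on the representative of `η` modulo `ℂ ⊗ N_ℚ`
(any `d t`; uses that the complex radical is `conj`-stable, `hr3s_conj_radical`, and the graded symmetry of the trace pairing) -/
theorem hr3t_HR_form_lift_indep (η ν : (toyUniverse₃ d t).CohC ((toyUniverse₃ d t).pms L ι₁ V Γ) 2)
    (hν : ν ∈ ((toyUniverse₃ d t).trCupRad ((toyUniverse₃ d t).pms L ι₁ V Γ) 2).baseChange ℂ) :
    (toyUniverse₃ d t).trC ((toyUniverse₃ d t).pms L ι₁ V Γ) 4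
        ((toyUniverse₃ d t).cup2C ((toyUniverse₃ d t).pms L ι₁ V Γ) 2 (η + ν) (conj (η + ν)))
      = (toyUniverse₃ d t).trC ((toyUniverse₃ d t).pms L ι₁ V Γ) 4
        ((toyUniverse₃ d t).cup2C ((toyUniverse₃ d t).pms L ι₁ V Γ) 2 η (conj η)) := by
  have hrad := ((toyUniverse₃ d t).isRadicalC_iff_mem_baseChange _ 2 ν).mpr hν
  have hrad4 : ∀ z, (toyUniverse₃ d t).trC ((toyUniverse₃ d t).pms L ι₁ V Γ) 4
      ((toyUniverse₃ d t).cup2C ((toyUniverse₃ d t).pms L ι₁ V Γ) 2 ν z) = 0 := hrad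
  have hradc4 : ∀ z, (toyUniverse₃ d t).trC ((toyUniverse₃ d t).pms L ι₁ V Γ) 4
      ((toyUniverse₃ d t).cup2C ((toyUniverse₃ d t).pms L ι₁ V Γ) 2 (conj ν) z) = 0 := hr3s_conj_radical d t ι₁ Γ hrad
  -- `tr(η ∪ conj ν) = tr(conj ν ∪ η) = 0` by graded symmetry (even degrees)
  have hsym : ∀ x y : (toyUniverse₃ d t).CohC ((toyUniverse₃ d t).pms L ι₁ V Γ) 2,
      (toyUniverse₃ d t).trC ((toyUniverse₃ d t).pms L ι₁ V Γ) 4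
          ((toyUniverse₃ d t).cup2C ((toyUniverse₃ d t).pms L ι₁ V Γ) 2 x y)
        = (toyUniverse₃ d t).trC ((toyUniverse₃ d t).pms L ι₁ V Γ) 4
          ((toyUniverse₃ d t).cup2C ((toyUniverse₃ d t).pms L ι₁ V Γ) 2 y x) := by
    intro x y
    induction x using TensorProduct.induction_on with
    | zero => simp only [LinearMap.map_zero, LinearMap.zero_apply]
    | add x₁ x₂ h₁ h₂ => simp only [LinearMap.map_add, LinearMap.add_apply, h₁, h₂]
    | tmul a x₀ =>
      induction y using TensorProduct.induction_on with
      | zero => simp only [LinearMap.map_zero, LinearMap.zero_apply]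
      | add y₁ y₂ h₁ h₂ => simp only [LinearMap.map_add, LinearMap.add_apply, h₁, h₂]
      | tmul b y₀ =>
        have e : (toyUniverse₃ d t).trC ((toyUniverse₃ d t).pms L ι₁ V Γ) (2 + 2)
              ((toyUniverse₃ d t).cup2C ((toyUniverse₃ d t).pms L ι₁ V Γ) 2 (a ⊗ₜ[ℚ] x₀) (b ⊗ₜ[ℚ] y₀))
            = (toyUniverse₃ d t).trC ((toyUniverse₃ d t).pms L ι₁ V Γ) (2 + 2)
              ((toyUniverse₃ d t).cup2C ((toyUniverse₃ d t).pms L ι₁ V Γ) 2 (b ⊗ₜ[ℚ] y₀) (a ⊗ₜ[ℚ] x₀)) := by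
          rw [Universe.trC_cup2C_tmul, Universe.trC_cup2C_tmul, mul_comm a b]
          congr 1
          show trOf ((toyUniverse₃ d t).pms L ι₁ V Γ).X (2 + 2) (Toy.wedge ℚ ((toyUniverse₃ d t).pms L ι₁ V Γ).X.L 2 2 x₀ y₀)
            = trOf ((toyUniverse₃ d t).pms L ι₁ V Γ).X (2 + 2) (Toy.wedge ℚ ((toyUniverse₃ d t).pms L ι₁ V Γ).X.L 2 2 y₀ x₀)
          rw [trOf_wedge_comm]
          norm_num
        exact e
  have hc : conj (η + ν) = conj η + conj ν := LinearMap.map_add _ _ _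
  rw [LinearMap.map_add₂, hc, ((toyUniverse₃ d t).cup2C ((toyUniverse₃ d t).pms L ι₁ V Γ) 2 η).map_add,
    ((toyUniverse₃ d t).cup2C ((toyUniverse₃ d t).pms L ι₁ V Γ) 2 ν).map_add, LinearMap.map_add, LinearMap.map_add,
    LinearMap.map_add, hrad4, hrad4, hsym η (conj ν), hradc4, add_zero, add_zero, add_zero]

section HR

variable (hd : (1 : ℚ) ≤ d) (ht : t ^ 2 = 16)
include hd ht

/-- **HR20 holds for the quotient `H²(P_Γ) ⧸ N_ℚ`** (`1 ≤ d`, `t² = 16`): a nonzero class `ξ ∈ F²` of the quotient Hodge structure lifts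
to `F²H²(P_Γ)`, and EVERY lift `η ∈ F²H²(P_Γ)` of `ξ` has `tr_ℂ(η ∪ conj η) ≠ 0` -/
theorem hr3t_HR20_quot
    (ξ : ℂ ⊗[ℚ] ((toyUniverse₃ d t).Coh ((toyUniverse₃ d t).pms L ι₁ V Γ) 2
      ⧸ (toyUniverse₃ d t).trCupRad ((toyUniverse₃ d t).pms L ι₁ V Γ) 2))
    (hξ : ξ ∈ (hr3t_quotHodge d t ι₁ Γ).F 2) (hξ0 : ξ ≠ 0) :
    (∃ η, η ∈ ((toyUniverse₃ d t).hodge ((toyUniverse₃ d t).pms L ι₁ V Γ) 2).F 2 ∧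
        ((toyUniverse₃ d t).trCupRad ((toyUniverse₃ d t).pms L ι₁ V Γ) 2).mkQ.baseChange ℂ η = ξ) ∧
      ∀ η, η ∈ ((toyUniverse₃ d t).hodge ((toyUniverse₃ d t).pms L ι₁ V Γ) 2).F 2 →
        ((toyUniverse₃ d t).trCupRad ((toyUniverse₃ d t).pms L ι₁ V Γ) 2).mkQ.baseChange ℂ η = ξ →
          (toyUniverse₃ d t).trC ((toyUniverse₃ d t).pms L ι₁ V Γ) 4
            ((toyUniverse₃ d t).cup2C ((toyUniverse₃ d t).pms L ι₁ V Γ) 2 η (conj η)) ≠ 0 := by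
  refine ⟨QuotHS.exists_lift_of_mem_quot_F _ _ _ hξ, fun η hη he h0 => hξ0 ?_⟩
  rw [← he]
  exact (QuotHS.mem_ker_mkQ_baseChange_iff _ η).mpr ((hr3q_isotropic_iff_mem_ratRadical d t ι₁ Γ hd ht hη).mp h0)

/-- pointwise form: for `η ∈ F²H²(P_Γ)`, `tr_ℂ(η ∪ conj η) = 0` iff the image of `η` in the quotient vanishes -/
theorem hr3t_isotropic_iff_mkQ_eq_zero {η : (toyUniverse₃ d t).CohC ((toyUniverse₃ d t).pms L ι₁ V Γ) 2}
    (hη : η ∈ ((toyUniverse₃ d t).hodge ((toyUniverse₃ d t).pms L ι₁ V Γ) 2).F 2) :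
    (toyUniverse₃ d t).trC ((toyUniverse₃ d t).pms L ι₁ V Γ) 4
        ((toyUniverse₃ d t).cup2C ((toyUniverse₃ d t).pms L ι₁ V Γ) 2 η (conj η)) = 0
      ↔ ((toyUniverse₃ d t).trCupRad ((toyUniverse₃ d t).pms L ι₁ V Γ) 2).mkQ.baseChange ℂ η = 0 := by
  rw [QuotHS.mem_ker_mkQ_baseChange_iff]
  exact hr3q_isotropic_iff_mem_ratRadical d t ι₁ Γ hd ht hη

/-- **the quotient has nonzero `(2,0)`-part** (`1 ≤ d`, `t² = 16`): the class `E_{q,2,θ} ∪ E_{q,3,θ}` of a block `q` is a `(2,0)`-class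
with `Lam ≠ 0` (`ThetaGram.Λ_theta23_ne_zero`), hence off the radical, hence nonzero in `F²` of the quotient — HR20 on the quotient
(`hr3t_HR20_quot`) is NOT vacuous -/
theorem hr3t_quot_F2_ne_bot (q : Fin (nQ L ι₁)) : (hr3t_quotHodge d t ι₁ Γ).F 2 ≠ ⊥ := by
  set η : (toyUniverse₃ d t).CohC ((toyUniverse₃ d t).pms L ι₁ V Γ) 2 :=
    (toyUniverse₃ d t).cup2C ((toyUniverse₃ d t).pms L ι₁ V Γ) 1 (eCls ι₁ d t q 2 (embOf L ι₁)) (eCls ι₁ d t q 3 (embOf L ι₁))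
    with hη
  have hF : η ∈ ((toyUniverse₃ d t).hodge ((toyUniverse₃ d t).pms L ι₁ V Γ) 2).F 2 :=
    Universe.cup2C_mem_F2 (toyUniverse₃_modelAxioms_all d t) _ (hr3k_eCls_mem_H10 d t ι₁ Γ q 2)
      (hr3k_eCls_mem_H10 d t ι₁ Γ q 3)
  have hLam : hr3g_Lam d t ι₁ Γ hd ht η ≠ 0 := by
    rw [hη, hr3g_Lam_cup]
    exact Λ_theta23_ne_zero ι₁ d t q hd ht (hr3k_embOf_hol ι₁ q 0) (hr3k_embOf_hol ι₁ q 1) (hr3k_embOf_hol ι₁ q 2)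
      (hr3k_embOf_hol ι₁ q 3)
  have hnrad : η ∉ ((toyUniverse₃ d t).trCupRad ((toyUniverse₃ d t).pms L ι₁ V Γ) 2).baseChange ℂ := fun hmem =>
    hLam ((hr3g_radical_iff_Lam_eq_zero d t ι₁ Γ hd ht hF).mp
      (((toyUniverse₃ d t).isRadicalC_iff_mem_baseChange _ 2 η).mpr hmem))
  intro hbot
  have hξ : ((toyUniverse₃ d t).trCupRad ((toyUniverse₃ d t).pms L ι₁ V Γ) 2).mkQ.baseChange ℂ η
      ∈ (hr3t_quotHodge d t ι₁ Γ).F 2 := Submodule.mem_map_of_mem hF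
  rw [hbot, Submodule.mem_bot, QuotHS.mem_ker_mkQ_baseChange_iff] at hξ
  exact hnrad hξ

/-- packaged: **the quotient `H²(P_Γ, ℚ) ⧸ N_ℚ` carries a weight-2 Hodge structure with nonzero `F²` on which HR20 holds**
(every lift `η ∈ F²H²(P_Γ)` of a nonzero `F²`-class of the quotient has `tr_ℂ(η ∪ conj η) ≠ 0`), `1 ≤ d`, `t² = 16` -/
theorem hr3t_quot_summary (q : Fin (nQ L ι₁)) :
    (hr3t_quotHodge d t ι₁ Γ).F 2 ≠ ⊥ ∧
      ∀ ξ ∈ (hr3t_quotHodge d t ι₁ Γ).F 2, ξ ≠ 0 →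
        ∀ η, η ∈ ((toyUniverse₃ d t).hodge ((toyUniverse₃ d t).pms L ι₁ V Γ) 2).F 2 →
          ((toyUniverse₃ d t).trCupRad ((toyUniverse₃ d t).pms L ι₁ V Γ) 2).mkQ.baseChange ℂ η = ξ →
            (toyUniverse₃ d t).trC ((toyUniverse₃ d t).pms L ι₁ V Γ) 4
              ((toyUniverse₃ d t).cup2C ((toyUniverse₃ d t).pms L ι₁ V Γ) 2 η (conj η)) ≠ 0 :=
  ⟨hr3t_quot_F2_ne_bot d t ι₁ Γ hd ht q, fun ξ hξ hξ0 => (hr3t_HR20_quot d t ι₁ Γ hd ht ξ hξ hξ0).2⟩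

end HR

end ToyG2

end

end HodgeCM
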